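import Summits.Ventures.HSemireg.WedgeHankelRecurrenceGaussChebyshevUWeights

/-!
# Venture HSemireg — **THE STIELTJES DICTIONARY AS ONE `TFAE`**: for a positive recurrence `q_0 = 1`, `q_1 = X − a_0`, `q_{n+2} = (X − a_{n+1}) q_{n+1} − b_{n+1} q_n` and a level `t`, the following
# are equivalent — (1) every zero of `q_{t+1}` is positive; (2) `(−1)^k q_k(0) > 0` for all `k ≤ t + 1` (no sign change of the Sturm sequence at `0`); (3) STIELTJES ∕ birth–death parameters
# `a_n = λ_n + μ_n`, `b_{n+1} = λ_n μ_{n+1}` (`μ_0 = 0`, `λ_n, μ_{n+1} > 0`) exist; (4) `a_n > 0` and `b_{n+1}∕(a_n a_{n+1})` is a CHAIN SEQUENCE with minimal parameters (`g_0 = 0`, `0 < g_n < 1`)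
# (Wall–Wetzel at the end point `0`)

HONEST FRAMING. Part of the Lean index of the computation cell `pub-hsemireg` (seat p10 gen 46, Sunday typer «UNIFORM-IN-n»).  A `List.TFAE` over statements already in the tree (N372, N373); no new
mathematics, no variety, no cohomology theory, no sheaf, no Ext group and no semiregularity map; nothing here says that HC / HC_CM / HC_AV holds; no Literature fact (unproved `Prop`) is declared or
used.  Custodian versions as in `WedgeHankelSiegelIdeal` (1/3).
SOURCES (cited).  T. J. Stieltjes, *Recherches sur les fractions continues* (1894); H. S. Wall, M. Wetzel, Duke Math. J. 11 (1944) 89–102; T. S. Chihara, *An Introduction to Orthogonal Polynomials*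
(1978), Ch. I Thm 9.1, Ch. III §5, Ch. IV Thm 2.1; S. Karlin, J. McGregor, Trans. Amer. Math. Soc. 85 (1957) 489–546; G. Szegő, *Orthogonal Polynomials*, Thm 3.3.4.
PROOF TYPED HERE.  (1) ⇔ (2): N372 `recurrence_forall_eval_alt_iff`; (1) ⇒ (3): N373 `birthDeath_of_zeros_pos`; (3) ⇒ (4): N373 `birthDeath_chain_params` (`g_n = μ_n∕(λ_n + μ_n)`); (4) ⇒ (1): N372
`zeros_gt_of_chain` with `A = 0`.
DEDUP DISCLOSURE (`rg -n 'positive_zeros_tfae|List.TFAE' Summits/Ventures/HSemireg/WedgeHankelRecurrenceGauss*`, 2026-09-03): no `TFAE` in the Gauss chapter (N24x `positivePair_even_tfae` is the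
Hurwitz dictionary).  The 1 name below: 0 hits tree-wide.

WHAT IS IN THE TREE.  N372, N373 as above.
THIS FILE (namespace `Summit.Ventures.HSemireg.Wedge.HankelOuter` continued; CHAINED on N384 (import only); 0 definitions):
* §1150 **`positive_zeros_tfae`**.
CAVEATS.  Packaging only.  Nothing Ext-side.  New name only.
-/

open Module Polynomial
open scoped Matrix Polynomial

namespace Summit.Ventures.HSemireg.Wedge.HankelOuter

/-! ## §1150. The Stieltjes dictionary -/

/-- **THE STIELTJES DICTIONARY: positive zeros ⇔ alternating values at `0` ⇔ birth–death parameters ⇔ a chain sequence at `0`.** [Stieltjes 1894; Wall–Wetzel 1944; Chihara I Thm 9.1, IV Thm 2.1;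
this file, §1150] -/
theorem positive_zeros_tfae {q : ℕ → ℝ[X]} {a b : ℕ → ℝ} (hq0 : q 0 = 1) (hq1 : q 1 = Polynomial.X - C (a 0))
    (hrec : ∀ n, q (n + 2) = (Polynomial.X - C (a (n + 1))) * q (n + 1) - C (b (n + 1)) * q n) (hb : ∀ j, 0 < b j) (t : ℕ) :
    List.TFAE [
      ∀ s, (q (t + 1)).eval s = 0 → 0 < s,
      ∀ k, k ≤ t + 1 → 0 < (-1 : ℝ) ^ k * (q k).eval 0,
      ∃ l m : ℕ → ℝ, m 0 = 0 ∧ (∀ n, n ≤ t → 0 < l n) ∧ (∀ n, n + 1 ≤ t → 0 < m (n + 1)) ∧ (∀ n, n ≤ t → a n = l n + m n) ∧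
        ∀ n, n + 1 ≤ t → b (n + 1) = l n * m (n + 1),
      (∀ n, n ≤ t → 0 < a n) ∧ ∃ g : ℕ → ℝ, g 0 = 0 ∧ (∀ n, n + 1 ≤ t → 0 < g (n + 1) ∧ g (n + 1) < 1) ∧
        ∀ n, n + 1 ≤ t → b (n + 1) = (1 - g n) * g (n + 1) * (a n * a (n + 1))] := by
  tfae_have 1 ↔ 2 := (recurrence_forall_eval_alt_iff hq0 hq1 hrec hb t 0).symm
  tfae_have 1 → 3 := fun h => by
    obtain ⟨l, m, hm0, hl, hm, ha, hbn, -⟩ := birthDeath_of_zeros_pos hq0 hq1 hrec hb h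
    exact ⟨l, m, hm0, hl, hm, ha, hbn⟩
  tfae_have 3 → 4 := by
    rintro ⟨l, m, hm0, hl, hm, ha, hbn⟩
    obtain ⟨hg0, hg, hgb⟩ := birthDeath_chain_params hm0 hl hm ha hbn
    have hmnn : ∀ n, n ≤ t → 0 ≤ m n := fun n hn => by
      rcases n with _ | k
      · rw [hm0]
      · exact (hm k hn).le
    refine ⟨fun n hn => by rw [ha n hn]; linarith [hl n hn, hmnn n hn], fun n => m n / (l n + m n), hg0, fun n hn => ⟨?_, (hg (n + 1) hn).2⟩, fun n hn => ?_⟩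
    · exact div_pos (hm n hn) (by linarith [hl (n + 1) hn, hm n hn])
    · have := hgb n hn; rwa [sub_zero, sub_zero] at this
  tfae_have 4 → 1 := by
    rintro ⟨hapos, g, hg0, hg, hgb⟩
    refine zeros_gt_of_chain hq0 hq1 hrec hb (A := 0) (g := g) hapos (fun n hn => ?_) fun n hn => by rw [sub_zero, sub_zero]; exact (hgb n hn).le
    rcases n with _ | k
    · rw [hg0]; exact ⟨le_rfl, one_pos⟩
    · exact ⟨(hg k hn).1.le, (hg k hn).2⟩
  tfae_finish

end Summit.Ventures.HSemireg.Wedge.HankelOuter
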